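import Summits.CriticalPhenomena.PercolationContinuityZ3.Theorems.PercNearOneGluingNoHeavyLowerTailAPLTreeFourPointEdge
import HarnessLib

/-!
# `NoHeavyLowerTail` (stmt-CriticalPhenomena-4575) — the sharp four-point tree inequality (T3′): mixing lemma, increments, dead case

Support file (prover prim-ineq-gen-8 gen 40; `--supports stmt-CriticalPhenomena-4575`; memo
run/shared/lean/prim/prim-ineq-gen-8/FINDING-gen40-T3.md §1–§2).  No definitions, no named facts, no sorries.

`μ = prodBernoulli w` on the pairs of a finite vertex type `V`; glued apex set `S`, `I_S(y) = {S ~ y}`,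
`G_S(y,z) = {y↔z} ∪ (I_S y ∩ I_S z)`, `M_S(y|z,z') = I_S y ∩ (I_S z)ᶜ ∩ {z↔z'}` (see `…APLTreeFourPointEdge.lean`).  This file supplies the
three remaining ingredients of the induction in `…APLTreeFourPointAll.lean`:
* `treeFourPoint_mixture` — the one-edge MIXING LEMMA (pure algebra): along the weight `z` of an apex edge every probability is affine,
  the (T3′)-slack is the cubic `(1−z)·slack₀ + z·slack₁ − z(1−z)·[Q₀ + 2δ_uδ_vδ_x(1+z)]` and `Q₀ ≥ 0` under the cross-row bounds, so the
  slack is convex in `z` and the inequality propagates from the two endpoints;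
* `glued_increment_le` — the cross-row bound `μ(G_{S∪t}(y,z)) − μ(G_S(y,z)) ≤ μ(I_S y)·δ_z + μ(I_S z)·δ_y`, `δ_y = μ(I_{S∪t} y) − μ(I_S y)`
  (from `APL.cross_row`, the van den Berg–Häggström–Kahn instance, and `APL.glued_diff_subset`);
* `dead_reach`, `dead_reach3`, `dead_split`, `dead_glued` — the values of all ten probabilities when no pair of positive weight leaves
  `S` (then `I_S y` is null for `y ∉ S` and sure for `y ∈ S`), which make the slack vanish identically in the base case.
[this work]
-/

noncomputable section

namespace Summit.CriticalPhenomena.PercolationContinuityZ3.Theorems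

namespace APL

open MeasureTheory Set Literature.Probability.Percolation Literature.Probability.LatticeModels
open scoped Classical

variable {V : Type*}

/-! ### The mixing lemma (convexity of the slack along an apex edge) -/

/-- **Mixing lemma for (T3′).**  Endpoint data `X₀, X₁` of the ten probabilities (`τ_y = P(S~y)`, `G_{zz'}`, `P₄`, `M_y`), with
`τ` non-decreasing, the three cross-row bounds `G¹_{zz'} − G⁰_{zz'} ≤ τ⁰_z δ_{z'} + τ⁰_{z'} δ_z` (`δ = τ¹ − τ⁰`), and the inequality at
both endpoints imply the inequality at every `z ∈ [0,1]` for the affine interpolants: the slack is the cubic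
`(1−z)s₀ + z s₁ − z(1−z)(Q₀ + 2δ_uδ_vδ_x(1+z))` with `Q₀ = 2Σ δδτ⁰ − Σ δ·ΔG ≥ 0`. [this work] -/
theorem treeFourPoint_mixture
    (tu0 tu1 tv0 tv1 tx0 tx1 Gvx0 Gvx1 Gux0 Gux1 Guv0 Guv1 P0 P1 Mu0 Mu1 Mv0 Mv1 Mx0 Mx1 z : ℝ)
    (hu : tu0 ≤ tu1) (hv : tv0 ≤ tv1) (hx : tx0 ≤ tx1)
    (hGvx : Gvx1 - Gvx0 ≤ tv0 * (tx1 - tx0) + tx0 * (tv1 - tv0))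
    (hGux : Gux1 - Gux0 ≤ tu0 * (tx1 - tx0) + tx0 * (tu1 - tu0))
    (hGuv : Guv1 - Guv0 ≤ tu0 * (tv1 - tv0) + tv0 * (tu1 - tu0))
    (h0 : P0 + Mu0 + Mv0 + Mx0 + 2 * tu0 * tv0 * tx0 ≤ tu0 * Gvx0 + tv0 * Gux0 + tx0 * Guv0)
    (h1 : P1 + Mu1 + Mv1 + Mx1 + 2 * tu1 * tv1 * tx1 ≤ tu1 * Gvx1 + tv1 * Gux1 + tx1 * Guv1)
    (hz0 : 0 ≤ z) (hz1 : z ≤ 1) :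
    ((1 - z) * P0 + z * P1) + ((1 - z) * Mu0 + z * Mu1) + ((1 - z) * Mv0 + z * Mv1) + ((1 - z) * Mx0 + z * Mx1)
        + 2 * ((1 - z) * tu0 + z * tu1) * ((1 - z) * tv0 + z * tv1) * ((1 - z) * tx0 + z * tx1) ≤
      ((1 - z) * tu0 + z * tu1) * ((1 - z) * Gvx0 + z * Gvx1) + ((1 - z) * tv0 + z * tv1) * ((1 - z) * Gux0 + z * Gux1)
        + ((1 - z) * tx0 + z * tx1) * ((1 - z) * Guv0 + z * Guv1) := by
  -- the z²-coefficient `Q₀` of the slack is non-negative by the cross-row bounds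
  have hdu : 0 ≤ tu1 - tu0 := by linarith
  have hdv : 0 ≤ tv1 - tv0 := by linarith
  have hdx : 0 ≤ tx1 - tx0 := by linarith
  have e1 := mul_le_mul_of_nonneg_left hGvx hdu
  have e2 := mul_le_mul_of_nonneg_left hGux hdv
  have e3 := mul_le_mul_of_nonneg_left hGuv hdx
  have hQ : 0 ≤ ((tu1 - tu0) * (tv0 * (tx1 - tx0) + tx0 * (tv1 - tv0)) - (tu1 - tu0) * (Gvx1 - Gvx0))
      + ((tv1 - tv0) * (tu0 * (tx1 - tx0) + tx0 * (tu1 - tu0)) - (tv1 - tv0) * (Gux1 - Gux0))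
      + ((tx1 - tx0) * (tu0 * (tv1 - tv0) + tv0 * (tu1 - tu0)) - (tx1 - tx0) * (Guv1 - Guv0)) := by
    have f1 : 0 ≤ (tu1 - tu0) * (tv0 * (tx1 - tx0) + tx0 * (tv1 - tv0)) - (tu1 - tu0) * (Gvx1 - Gvx0) := sub_nonneg.2 e1
    have f2 : 0 ≤ (tv1 - tv0) * (tu0 * (tx1 - tx0) + tx0 * (tu1 - tu0)) - (tv1 - tv0) * (Gux1 - Gux0) := sub_nonneg.2 e2
    have f3 : 0 ≤ (tx1 - tx0) * (tu0 * (tv1 - tv0) + tv0 * (tu1 - tu0)) - (tx1 - tx0) * (Guv1 - Guv0) := sub_nonneg.2 e3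
    exact add_nonneg (add_nonneg f1 f2) f3
  -- the z³-part
  have hC : 0 ≤ (tu1 - tu0) * (tv1 - tv0) * (tx1 - tx0) * (1 + z) :=
    mul_nonneg (mul_nonneg (mul_nonneg hdu hdv) hdx) (by linarith)
  have hzz : 0 ≤ z * (1 - z) := mul_nonneg hz0 (by linarith)
  have hs0 : P0 + Mu0 + Mv0 + Mx0 + 2 * tu0 * tv0 * tx0 - (tu0 * Gvx0 + tv0 * Gux0 + tx0 * Guv0) ≤ 0 := sub_nonpos.2 h0
  have hs1 : P1 + Mu1 + Mv1 + Mx1 + 2 * tu1 * tv1 * tx1 - (tu1 * Gvx1 + tv1 * Gux1 + tx1 * Guv1) ≤ 0 := sub_nonpos.2 h1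
  have m0 : (1 - z) * (P0 + Mu0 + Mv0 + Mx0 + 2 * tu0 * tv0 * tx0 - (tu0 * Gvx0 + tv0 * Gux0 + tx0 * Guv0)) ≤ 0 :=
    mul_nonpos_of_nonneg_of_nonpos (by linarith) hs0
  have m1 : z * (P1 + Mu1 + Mv1 + Mx1 + 2 * tu1 * tv1 * tx1 - (tu1 * Gvx1 + tv1 * Gux1 + tx1 * Guv1)) ≤ 0 :=
    mul_nonpos_of_nonneg_of_nonpos hz0 hs1
  have mQ : 0 ≤ z * (1 - z) * ((((tu1 - tu0) * (tv0 * (tx1 - tx0) + tx0 * (tv1 - tv0)) - (tu1 - tu0) * (Gvx1 - Gvx0))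
      + ((tv1 - tv0) * (tu0 * (tx1 - tx0) + tx0 * (tu1 - tu0)) - (tv1 - tv0) * (Gux1 - Gux0))
      + ((tx1 - tx0) * (tu0 * (tv1 - tv0) + tv0 * (tu1 - tu0)) - (tx1 - tx0) * (Guv1 - Guv0)))
      + 2 * ((tu1 - tu0) * (tv1 - tv0) * (tx1 - tx0) * (1 + z))) :=
    mul_nonneg hzz (by linarith)
  -- the cubic identity: slack(z) = (1-z)·slack₀ + z·slack₁ − z(1−z)·(Q₀ + 2δδδ(1+z))
  have key : ((1 - z) * P0 + z * P1) + ((1 - z) * Mu0 + z * Mu1) + ((1 - z) * Mv0 + z * Mv1) + ((1 - z) * Mx0 + z * Mx1)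
        + 2 * ((1 - z) * tu0 + z * tu1) * ((1 - z) * tv0 + z * tv1) * ((1 - z) * tx0 + z * tx1)
        - (((1 - z) * tu0 + z * tu1) * ((1 - z) * Gvx0 + z * Gvx1) + ((1 - z) * tv0 + z * tv1) * ((1 - z) * Gux0 + z * Gux1)
          + ((1 - z) * tx0 + z * tx1) * ((1 - z) * Guv0 + z * Guv1)) =
      (1 - z) * (P0 + Mu0 + Mv0 + Mx0 + 2 * tu0 * tv0 * tx0 - (tu0 * Gvx0 + tv0 * Gux0 + tx0 * Guv0))
        + z * (P1 + Mu1 + Mv1 + Mx1 + 2 * tu1 * tv1 * tx1 - (tu1 * Gvx1 + tv1 * Gux1 + tx1 * Guv1))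
        - z * (1 - z) * ((((tu1 - tu0) * (tv0 * (tx1 - tx0) + tx0 * (tv1 - tv0)) - (tu1 - tu0) * (Gvx1 - Gvx0))
          + ((tv1 - tv0) * (tu0 * (tx1 - tx0) + tx0 * (tu1 - tu0)) - (tv1 - tv0) * (Gux1 - Gux0))
          + ((tx1 - tx0) * (tu0 * (tv1 - tv0) + tv0 * (tu1 - tu0)) - (tx1 - tx0) * (Guv1 - Guv0)))
          + 2 * ((tu1 - tu0) * (tv1 - tv0) * (tx1 - tx0) * (1 + z))) := by
    ring
  exact sub_nonpos.1 (by rw [key]; linarith)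

/-! ### Increments when `t` joins the glued apex set -/

section Increments

variable [Fintype V] (w : Sym2 V → unitInterval) (S : Set V) (t : V)

omit [Fintype V] in
/-- `I_S(x) ⊆ I_{S∪t}(x)`. [folklore] -/
theorem reach_subset_insert (x : V) :
    (⋃ u ∈ S, (openConn u x : Set (BondConfig V))) ⊆ (⋃ u ∈ insert t S, (openConn u x : Set (BondConfig V))) := by
  intro ω hω
  simp only [mem_iUnion, exists_prop] at hω ⊢
  obtain ⟨u, hu, hux⟩ := hω
  exact ⟨u, mem_insert_of_mem _ hu, hux⟩

omit [Fintype V] in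
/-- `{t ↔ x} ∩ {S ≁ t} ⊆ I_{S∪t}(x) ∖ I_S(x)`. [this work] -/
theorem conn_notReach_subset_diff (x : V) :
    (openConn t x : Set (BondConfig V)) ∩ (⋃ u ∈ S, (openConn u t : Set (BondConfig V)))ᶜ ⊆
      (⋃ u ∈ insert t S, (openConn u x : Set (BondConfig V))) ∩ (⋃ u ∈ S, (openConn u x : Set (BondConfig V)))ᶜ := by
  intro ω hω
  simp only [mem_inter_iff, mem_compl_iff, mem_iUnion, exists_prop, not_exists, not_and] at hω
  simp only [mem_inter_iff, mem_compl_iff, mem_iUnion, exists_prop, mem_insert_iff, not_exists, not_and]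
  exact ⟨⟨t, Or.inl rfl, hω.1⟩, fun u hu hux => hω.2 u hu (SimpleGraph.Reachable.trans hux (SimpleGraph.Reachable.symm hω.1))⟩

/-- `μ({t↔x} ∩ {S≁t}) ≤ μ(I_{S∪t}(x)) − μ(I_S(x))`. [this work] -/
theorem real_conn_notReach_le (x : V) :
    (prodBernoulli w).real ((openConn t x : Set (BondConfig V)) ∩ (⋃ u ∈ S, (openConn u t : Set (BondConfig V)))ᶜ) ≤
      (prodBernoulli w).real (⋃ u ∈ insert t S, (openConn u x : Set (BondConfig V)))
        - (prodBernoulli w).real (⋃ u ∈ S, (openConn u x : Set (BondConfig V))) := by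
  have hsplit := ClusterCovTransfer.real_eq_inter_add_inter_compl w (⋃ u ∈ insert t S, (openConn u x : Set (BondConfig V)))
    (⋃ u ∈ S, (openConn u x : Set (BondConfig V)))
  rw [inter_eq_self_of_subset_right (reach_subset_insert S t x)] at hsplit
  have hle := measureReal_mono (μ := prodBernoulli w) (conn_notReach_subset_diff S t x) (measure_ne_top _ _)
  linarith

/-- **Cross-row bound on the increment of the glued connection**:
`μ(G_{S∪t}(y,z)) − μ(G_S(y,z)) ≤ μ(I_S y)·(μ(I_{S∪t} z) − μ(I_S z)) + μ(I_S z)·(μ(I_{S∪t} y) − μ(I_S y))`. [this work] -/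
theorem glued_increment_le (y z : V) :
    (prodBernoulli w).real ((openConn y z : Set (BondConfig V)) ∪
          ((⋃ u ∈ insert t S, (openConn u y : Set (BondConfig V))) ∩ (⋃ u ∈ insert t S, (openConn u z : Set (BondConfig V)))))
        - (prodBernoulli w).real ((openConn y z : Set (BondConfig V)) ∪
          ((⋃ u ∈ S, (openConn u y : Set (BondConfig V))) ∩ (⋃ u ∈ S, (openConn u z : Set (BondConfig V))))) ≤
      (prodBernoulli w).real (⋃ u ∈ S, (openConn u y : Set (BondConfig V))) *
          ((prodBernoulli w).real (⋃ u ∈ insert t S, (openConn u z : Set (BondConfig V)))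
            - (prodBernoulli w).real (⋃ u ∈ S, (openConn u z : Set (BondConfig V)))) +
        (prodBernoulli w).real (⋃ u ∈ S, (openConn u z : Set (BondConfig V))) *
          ((prodBernoulli w).real (⋃ u ∈ insert t S, (openConn u y : Set (BondConfig V)))
            - (prodBernoulli w).real (⋃ u ∈ S, (openConn u y : Set (BondConfig V)))) := by
  set G1 := ((openConn y z : Set (BondConfig V)) ∪
    ((⋃ u ∈ insert t S, (openConn u y : Set (BondConfig V))) ∩ (⋃ u ∈ insert t S, (openConn u z : Set (BondConfig V)))))
    with hG1
  set G0 := ((openConn y z : Set (BondConfig V)) ∪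
    ((⋃ u ∈ S, (openConn u y : Set (BondConfig V))) ∩ (⋃ u ∈ S, (openConn u z : Set (BondConfig V))))) with hG0
  set E1 := ((⋃ u ∈ S, (openConn u y : Set (BondConfig V))) ∩ (openConn t z : Set (BondConfig V))
    ∩ (⋃ u ∈ S, (openConn u t : Set (BondConfig V)))ᶜ) with hE1
  set E2 := ((⋃ u ∈ S, (openConn u z : Set (BondConfig V))) ∩ (openConn t y : Set (BondConfig V))
    ∩ (⋃ u ∈ S, (openConn u t : Set (BondConfig V)))ᶜ) with hE2
  have hsub : G1 ⊆ G0 ∪ (E1 ∪ E2) := by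
    intro ω hω
    by_cases h0 : ω ∈ G0
    · exact Or.inl h0
    · exact Or.inr (glued_diff_subset S t y z ⟨hω, h0⟩)
  have h1 : (prodBernoulli w).real G1 ≤ (prodBernoulli w).real G0 + ((prodBernoulli w).real E1 + (prodBernoulli w).real E2) :=
    (measureReal_mono hsub (measure_ne_top _ _)).trans
      ((measureReal_union_le _ _).trans (add_le_add le_rfl (measureReal_union_le _ _)))
  have c1 := cross_row w S t y z
  have c2 := cross_row w S t z y
  have r1 := real_conn_notReach_le w S t z
  have r2 := real_conn_notReach_le w S t y
  have m1 := mul_le_mul_of_nonneg_left r1 (measureReal_nonneg (μ := prodBernoulli w)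
    (s := ⋃ u ∈ S, (openConn u y : Set (BondConfig V))))
  have m2 := mul_le_mul_of_nonneg_left r2 (measureReal_nonneg (μ := prodBernoulli w)
    (s := ⋃ u ∈ S, (openConn u z : Set (BondConfig V))))
  rw [← hE1] at c1
  rw [← hE2] at c2
  linarith

end Increments

/-! ### The dead case: no live pair leaves `S` -/

section Dead

variable [Fintype V] (w : Sym2 V → unitInterval) (S : Finset V)
  (hnull : ∀ x, x ∉ S → (prodBernoulli w).real (⋃ u ∈ (↑S : Set V), (openConn u x : Set (BondConfig V))) = 0)
include hnull

omit [Fintype V] hnull in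
/-- A vertex of `S` is reached by `S`. [folklore] -/
theorem reach_eq_univ_of_mem {x : V} (hx : x ∈ S) : (⋃ u ∈ (↑S : Set V), (openConn u x : Set (BondConfig V))) = univ := by
  ext ω
  simp only [mem_iUnion, exists_prop, mem_univ, iff_true]
  exact ⟨x, Finset.mem_coe.2 hx, (SimpleGraph.Reachable.refl x : ω ∈ (openConn x x : Set (BondConfig V)))⟩

omit [Fintype V] in
/-- Dead case: `μ(I_S x) = [x ∈ S]`. [this work] -/
theorem dead_reach (x : V) :
    (prodBernoulli w).real (⋃ u ∈ (↑S : Set V), (openConn u x : Set (BondConfig V))) = if x ∈ S then 1 else 0 := by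
  split_ifs with hx
  · rw [reach_eq_univ_of_mem S hx, probReal_univ]
  · exact hnull x hx

omit [Fintype V] in
/-- Dead case: `μ(I u ∩ I v ∩ I x) = [u, v, x ∈ S]`. [this work] -/
theorem dead_reach3 (u v x : V) :
    (prodBernoulli w).real ((⋃ y ∈ (↑S : Set V), (openConn y u : Set (BondConfig V)))
        ∩ (⋃ y ∈ (↑S : Set V), (openConn y v : Set (BondConfig V))) ∩ (⋃ y ∈ (↑S : Set V), (openConn y x : Set (BondConfig V)))) =
      if (u ∈ S ∧ v ∈ S ∧ x ∈ S) then 1 else 0 := by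
  split_ifs with h
  · rw [reach_eq_univ_of_mem S h.1, reach_eq_univ_of_mem S h.2.1, reach_eq_univ_of_mem S h.2.2, univ_inter, univ_inter,
      probReal_univ]
  · refine le_antisymm ?_ measureReal_nonneg
    simp only [not_and_or] at h
    rcases h with h | h | h
    · rw [← hnull u h]; exact measureReal_mono (fun ω hω => hω.1.1) (measure_ne_top _ _)
    · rw [← hnull v h]; exact measureReal_mono (fun ω hω => hω.1.2) (measure_ne_top _ _)
    · rw [← hnull x h]; exact measureReal_mono (fun ω hω => hω.2) (measure_ne_top _ _)

/-- Dead case: `μ(I x ∩ (I y)ᶜ ∩ {y↔z}) = [x ∈ S, y ∉ S, z ∉ S]·μ(y↔z)`. [this work] -/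
theorem dead_split (x y z : V) :
    (prodBernoulli w).real ((⋃ u ∈ (↑S : Set V), (openConn u x : Set (BondConfig V)))
        ∩ (⋃ u ∈ (↑S : Set V), (openConn u y : Set (BondConfig V)))ᶜ ∩ (openConn y z : Set (BondConfig V))) =
      if (x ∈ S ∧ y ∉ S ∧ z ∉ S) then (prodBernoulli w).real (openConn y z : Set (BondConfig V)) else 0 := by
  split_ifs with h
  · rw [reach_eq_univ_of_mem S h.1, univ_inter]
    have hs := ClusterCovTransfer.real_eq_inter_add_inter_compl w (openConn y z : Set (BondConfig V))
      (⋃ u ∈ (↑S : Set V), (openConn u y : Set (BondConfig V)))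
    have h0 : (prodBernoulli w).real ((openConn y z : Set (BondConfig V)) ∩ ⋃ u ∈ (↑S : Set V), (openConn u y : Set (BondConfig V))) = 0 :=
      le_antisymm ((measureReal_mono inter_subset_right (measure_ne_top _ _)).trans_eq (hnull y h.2.1)) measureReal_nonneg
    rw [h0, zero_add, inter_comm] at hs
    exact hs.symm
  · refine le_antisymm ?_ measureReal_nonneg
    simp only [not_and_or, not_not] at h
    rcases h with h | h | h
    · rw [← hnull x h]; exact measureReal_mono (fun ω hω => hω.1.1) (measure_ne_top _ _)
    · rw [reach_eq_univ_of_mem S h, compl_univ, inter_empty, empty_inter, measureReal_empty]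
    · have hem : ((⋃ u ∈ (↑S : Set V), (openConn u x : Set (BondConfig V)))
          ∩ (⋃ u ∈ (↑S : Set V), (openConn u y : Set (BondConfig V)))ᶜ ∩ (openConn y z : Set (BondConfig V))) = ∅ := by
        ext ω
        constructor
        · rintro ⟨⟨_, hy⟩, hyz⟩
          refine (hy ?_).elim
          simp only [mem_iUnion, exists_prop]
          exact ⟨z, Finset.mem_coe.2 h, SimpleGraph.Reachable.symm hyz⟩
        · intro hω; exact hω.elim
      rw [hem, measureReal_empty]

omit [Fintype V] in
/-- Dead case: `μ({y↔z} ∪ (I y ∩ I z)) = [y,z ∈ S] + [y,z ∉ S]·μ(y↔z)`. [this work] -/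
theorem dead_glued (y z : V) :
    (prodBernoulli w).real ((openConn y z : Set (BondConfig V)) ∪
        ((⋃ u ∈ (↑S : Set V), (openConn u y : Set (BondConfig V))) ∩ (⋃ u ∈ (↑S : Set V), (openConn u z : Set (BondConfig V))))) =
      if (y ∈ S ∧ z ∈ S) then 1 else if (y ∉ S ∧ z ∉ S) then (prodBernoulli w).real (openConn y z : Set (BondConfig V)) else 0 := by
  split_ifs with h1 h2
  · rw [reach_eq_univ_of_mem S h1.1, reach_eq_univ_of_mem S h1.2, univ_inter, union_univ, probReal_univ]
  · refine le_antisymm ?_ (measureReal_mono subset_union_left (measure_ne_top _ _))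
    refine (measureReal_union_le _ _).trans ?_
    have h0 : (prodBernoulli w).real ((⋃ u ∈ (↑S : Set V), (openConn u y : Set (BondConfig V)))
        ∩ (⋃ u ∈ (↑S : Set V), (openConn u z : Set (BondConfig V)))) = 0 :=
      le_antisymm ((measureReal_mono inter_subset_left (measure_ne_top _ _)).trans_eq (hnull y h2.1)) measureReal_nonneg
    rw [h0, add_zero]
  · refine le_antisymm ?_ measureReal_nonneg
    simp only [not_and_or, not_not] at h1 h2
    -- exactly one of `y, z` lies in `S`
    rcases h2 with hy | hz
    · -- `y ∈ S`, hence `z ∉ S`; everything is inside `I z`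
      have hz : z ∉ S := fun hz => h1.elim (fun h => h hy) (fun h => h hz)
      rw [← hnull z hz]
      refine measureReal_mono (fun ω hω => ?_) (measure_ne_top _ _)
      rcases hω with hω | hω
      · simp only [mem_iUnion, exists_prop]
        exact ⟨y, Finset.mem_coe.2 hy, hω⟩
      · exact hω.2
    · have hy : y ∉ S := fun hy => h1.elim (fun h => h hy) (fun h => h hz)
      rw [← hnull y hy]
      refine measureReal_mono (fun ω hω => ?_) (measure_ne_top _ _)
      rcases hω with hω | hω
      · simp only [mem_iUnion, exists_prop]
        exact ⟨z, Finset.mem_coe.2 hz, SimpleGraph.Reachable.symm hω⟩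
      · exact hω.1

end Dead

end APL

end Summit.CriticalPhenomena.PercolationContinuityZ3.Theorems

end
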